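import Mathlib
import Summits.Ventures.HodgeRepro.Tier4.Line3.Defs
import Summits.Ventures.HodgeRepro.Tier4.Line3.KMDatumS
import Summits.Ventures.HodgeRepro.Tier4.Common.TargetCalculus
import Summits.Ventures.HodgeRepro.Tier4.Common.TargetBall

/-!
# Tier4/Line3/HeckeEquivarianceLemmas — the helper lemmas of L3.1 `pd_heckeTranslate` (LINE L3)

Blind re-derivation cell `pub-hodge-repro`, Tier 4 «PROVE THE STEP» (README §9–§10), seat t4-L3-p2 (gen 0), seated
against LINE L3 (`Tier4/Line3/Skeleton.lean` v0.9, sha256 2a72f2df757f9b35dc45581d457b806bb6ca5e414894548e5bc80727a8b1db53,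
944 l.; lead S12104 / S12121: «t4-L3-p2 … then takes L3.1 `pd_heckeTranslate`»).  The registered statement is proved in
`Tier4/Line3/HeckeEquivariance.lean`; this module (split off by the gate's 400-line rule for files with proofs) holds the
Mathlib-level helpers, all in the sub-namespace `…Line3.HeckeEquivariance` (no name collides with the skeleton's or with
the other landed L3 modules): §1 `pd` of finite sums of differentiable functions; §3 `lineStep` is an
equivalence relation, the summand of `theta` is a function of the line, `ballCoord` intertwines `r` with
`M(r) = toBallMat τ₀ C r`, and `x ↦ r *ᵥ x` descends to a bijection `lineEquiv` of `Line` for a unit `r`; §4 coset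
representatives of a Hecke element of level `Γ′` lie in `U(H)(E′)`, are units (`H` is a unit by anisotropy) and have
`J`-unitary transfers; §5 finite list sums through `tsum`.  The line's definitions are imported from `Tier4/Line3/Defs.lean`
and `Tier4/Line3/KMDatum.lean` (t4-L3-p1; L3.e `datum_smul` is consumed in §3), the calculus on the target's objects from
t4-typer-2's `Tier4/Common/TargetCalculus.lean` (`pd_add`, `pd_smul`, `pd_const`) and `Tier4/Common/TargetBall.lean`
(`toBallMat_J`, `complexConj_intertwines`).  No printed input enters.

Nothing here says anything about the status of the Hodge conjecture for CM abelian varieties, which is NOT proved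
(HC_CM is NOT proved by anyone in this repository).
-/

set_option autoImplicit false

noncomputable section

namespace Summit.Ventures.HodgeRepro.Tier4.Line3

open Summit.Ventures.HodgeRepro.Tier4
open Matrix
open scoped ComplexConjugate

namespace HeckeEquivariance

/-! ### 1. Calculus: `pd` of finite sums of differentiable functions -/

section Calculus

variable {z : Fin 2 → ℂ}

/-- `pd` of a `Finset` sum. -/
theorem pd_finset_sum {ι : Type} (k : Fin 2) (s : Finset ι) (f : ι → (Fin 2 → ℂ) → ℂ)
    (hf : ∀ r ∈ s, DifferentiableAt ℂ (f r) z) :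
    pd k (fun w => ∑ r ∈ s, f r w) z = ∑ r ∈ s, pd k (f r) z := by
  simp only [pd]
  rw [fderiv_fun_sum hf]
  simp only [_root_.sum_apply]

/-- A list sum of functions differentiable at `z` is differentiable at `z`. -/
theorem differentiableAt_list_sum {ι : Type} (l : List ι) (f : ι → (Fin 2 → ℂ) → ℂ)
    (hf : ∀ t ∈ l, DifferentiableAt ℂ (f t) z) :
    DifferentiableAt ℂ (fun w => (l.map (fun t => f t w)).sum) z := by
  induction l with
  | nil =>
    simp only [List.map_nil, List.sum_nil]
    exact differentiableAt_const 0
  | cons t l ih =>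
    simp only [List.map_cons, List.sum_cons]
    exact (hf t (by simp)).add (ih fun t' ht' => hf t' (by simp [ht']))

/-- `pd` of a list sum. -/
theorem pd_list_sum {ι : Type} (k : Fin 2) (l : List ι) (f : ι → (Fin 2 → ℂ) → ℂ)
    (hf : ∀ t ∈ l, DifferentiableAt ℂ (f t) z) :
    pd k (fun w => (l.map (fun t => f t w)).sum) z = (l.map (fun t => pd k (f t) z)).sum := by
  induction l with
  | nil =>
    simp only [List.map_nil, List.sum_nil]
    exact pd_const k 0
  | cons t l ih =>
    simp only [List.map_cons, List.sum_cons]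
    have h1 : DifferentiableAt ℂ (f t) z := hf t (by simp)
    have h2 : DifferentiableAt ℂ (fun w => (l.map (fun t => f t w)).sum) z :=
      differentiableAt_list_sum l f (fun t' ht' => hf t' (by simp [ht']))
    rw [show (fun w => f t w + (l.map (fun t => f t w)).sum) =
        f t + fun w => (l.map (fun t => f t w)).sum from rfl, pd_add k h1 h2,
      ih (fun t' ht' => hf t' (by simp [ht']))]

/-- `pd` of an integer multiple. -/
theorem pd_zsmul (k : Fin 2) (n : ℤ) {f : (Fin 2 → ℂ) → ℂ} (hf : DifferentiableAt ℂ f z) :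
    pd k (fun w => n • f w) z = n • pd k f z := by
  have h : (fun w => n • f w) = (n : ℂ) • f := by
    funext w
    simp [zsmul_eq_mul]
  rw [h, pd_smul k (n : ℂ) hf, zsmul_eq_mul]

/-- An integer multiple of a differentiable function is differentiable. -/
theorem differentiableAt_zsmul (n : ℤ) {f : (Fin 2 → ℂ) → ℂ} (hf : DifferentiableAt ℂ f z) :
    DifferentiableAt ℂ (fun w => n • f w) z := by
  have h : (fun w => n • f w) = (n : ℂ) • f := by
    funext w
    simp [zsmul_eq_mul]
  rw [h]
  exact hf.const_smul (n : ℂ)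

/-- The open unit ball is open. -/
theorem isOpen_ball' : IsOpen ball := by
  have hc : Continuous nsq := by
    unfold nsq
    fun_prop
  exact isOpen_lt hc continuous_const

end Calculus

/-! ### 3. Lines: `lineStep` is an equivalence relation; the summand of `theta` is a function of the line -/

section Lines

variable (X : T4Data)

/-- `lineStep` is reflexive (`t = 1`). -/
theorem lineStep_refl (x : Fin 3 → X.E) : X.lineStep x x :=
  ⟨1, by simp, by simp⟩

/-- `lineStep` is symmetric (`t ↦ t⁻¹`, of norm one). -/
theorem lineStep_symm {x x' : Fin 3 → X.E} (h : X.lineStep x x') : X.lineStep x' x := by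
  obtain ⟨t, ht, rfl⟩ := h
  have ht0 : t ≠ 0 := by
    rintro rfl
    simp at ht
  refine ⟨t⁻¹, ?_, ?_⟩
  · rw [map_inv₀, ← mul_inv, ht, inv_one]
  · rw [smul_smul, inv_mul_cancel₀ ht0, one_smul]

/-- `lineStep` is transitive (`t ↦ s * t`). -/
theorem lineStep_trans {x x' x'' : Fin 3 → X.E} (h : X.lineStep x x') (h' : X.lineStep x' x'') :
    X.lineStep x x'' := by
  obtain ⟨t, ht, rfl⟩ := h
  obtain ⟨s, hs, rfl⟩ := h'
  refine ⟨s * t, ?_, ?_⟩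
  · rw [map_mul]
    calc X.c s * X.c t * (s * t) = (X.c s * s) * (X.c t * t) := by ring
      _ = 1 := by rw [hs, ht, one_mul]
  · rw [smul_smul]

/-- `lineStep` is an equivalence relation, so `Line` is the set of its classes. -/
theorem lineStep_equivalence : Equivalence X.lineStep :=
  ⟨lineStep_refl X, fun h => lineStep_symm X h, fun h h' => lineStep_trans X h h'⟩

/-- Equal lines are `lineStep`-related. -/
theorem lineStep_of_mk_eq {x x' : Fin 3 → X.E} (h : Quot.mk X.lineStep x = Quot.mk X.lineStep x') :
    X.lineStep x x' :=
  ((lineStep_equivalence X).eqvGen_iff).mp (Quot.eqvGen_exact h)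

/-- The chosen representative of the line of `x` is `lineStep`-related to `x`. -/
theorem lineStep_out_mk (x : Fin 3 → X.E) : X.lineStep x (Quot.out (Quot.mk X.lineStep x)) :=
  lineStep_of_mk_eq X (Quot.out_eq (Quot.mk X.lineStep x)).symm

/-- `τ₀` of a norm-one element has absolute value `1`. -/
theorem norm_τ₀_eq_one {t : X.E} (ht : X.c t * t = 1) : ‖X.τ₀ t‖ = 1 := by
  have h1 : X.τ₀ (X.c t) * X.τ₀ t = 1 := by rw [← map_mul, ht, map_one]
  have h2 : X.τ₀ (X.c t) = conj (X.τ₀ t) := complexConj_intertwines X.E X.τ₀ t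
  rw [h2, ← Complex.normSq_eq_conj_mul_self, Complex.normSq_eq_norm_sq] at h1
  have h3 : ‖X.τ₀ t‖ ^ 2 = 1 := by exact_mod_cast h1
  exact (pow_eq_one_iff_of_nonneg (norm_nonneg _) two_ne_zero).mp h3

/-- Ball coordinates are `τ₀`-homogeneous. -/
theorem ballCoord_smul (t : X.E) (x : Fin 3 → X.E) : X.ballCoord (t • x) = X.τ₀ t • X.ballCoord x := by
  unfold T4Data.ballCoord
  rw [← Matrix.mulVec_smul]
  congr 1
  funext i
  simp [map_mul]

/-- Ball coordinates intertwine `r` with `M(r) = toBallMat τ₀ C r`. -/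
theorem ballCoord_mulVec (r : Matrix (Fin 3) (Fin 3) X.E) (x : Fin 3 → X.E) :
    X.ballCoord (r *ᵥ x) = toBallMat X.τ₀ X.C r *ᵥ X.ballCoord x := by
  unfold T4Data.ballCoord toBallMat
  have h : (fun i => X.τ₀ ((r *ᵥ x) i)) = r.map X.τ₀ *ᵥ fun i => X.τ₀ (x i) := by
    funext i
    rw [RingHom.map_mulVec]
    rfl
  rw [h, Matrix.mulVec_mulVec, Matrix.mulVec_mulVec, Matrix.mul_nonsing_inv_cancel_right]
  exact (Matrix.isUnit_iff_isUnit_det X.C).mp X.hC.1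

/-- The summand of the theta series is a function of the line (the coefficients and the datum are both invariant
under the unit scalars: `ThetaData.weight`, `datum_smul`). -/
theorem summand_lineStep (Φ : KMDatumS) (c : (Fin 3 → X.E) → ℂ)
    (hw : ∀ t : X.E, X.c t * t = 1 → ∀ x, c (t • x) = c x)
    {x x' : Fin 3 → X.E} (h : X.lineStep x x') (w : Fin 2 → ℂ) (l : Fin 2) :
    c x' * datumS Φ (X.ballCoord x') w l = c x * datumS Φ (X.ballCoord x) w l := by
  obtain ⟨t, ht, rfl⟩ := h
  rw [hw t ht, ballCoord_smul, datumS_smul Φ _ (norm_τ₀_eq_one X ht)]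

/-- The summand at the chosen representative of the line of `x` is the summand at `x`. -/
theorem summand_out_mk (Φ : KMDatumS) (c : (Fin 3 → X.E) → ℂ)
    (hw : ∀ t : X.E, X.c t * t = 1 → ∀ x, c (t • x) = c x)
    (x : Fin 3 → X.E) (w : Fin 2 → ℂ) (l : Fin 2) :
    c (Quot.out (Quot.mk X.lineStep x)) * datumS Φ (X.ballCoord (Quot.out (Quot.mk X.lineStep x))) w l =
      c x * datumS Φ (X.ballCoord x) w l :=
  summand_lineStep X Φ c hw (lineStep_out_mk X x) w l

/-- `x ↦ r *ᵥ x` descends to the lines. -/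
def lineMap (r : Matrix (Fin 3) (Fin 3) X.E) : X.Line → X.Line :=
  Quot.lift (fun x => Quot.mk X.lineStep (r *ᵥ x)) (fun x x' h => by
    obtain ⟨t, ht, rfl⟩ := h
    apply Quot.sound
    exact ⟨t, ht, Matrix.mulVec_smul r t x⟩)

/-- `lineMap` on a class. -/
theorem lineMap_mk (r : Matrix (Fin 3) (Fin 3) X.E) (x : Fin 3 → X.E) :
    lineMap X r (Quot.mk X.lineStep x) = Quot.mk X.lineStep (r *ᵥ x) := rfl

/-- For a unit `r`, `x ↦ r *ᵥ x` is a bijection of the lines. -/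
def lineEquiv (r : Matrix (Fin 3) (Fin 3) X.E) (hr : IsUnit r.det) : X.Line ≃ X.Line where
  toFun := lineMap X r
  invFun := lineMap X r⁻¹
  left_inv := by
    intro o
    obtain ⟨x, rfl⟩ := Quot.exists_rep o
    show Quot.mk X.lineStep (r⁻¹ *ᵥ (r *ᵥ x)) = Quot.mk X.lineStep x
    rw [Matrix.mulVec_mulVec, Matrix.nonsing_inv_mul r hr, Matrix.one_mulVec]
  right_inv := by
    intro o
    obtain ⟨x, rfl⟩ := Quot.exists_rep o
    show Quot.mk X.lineStep (r *ᵥ (r⁻¹ *ᵥ x)) = Quot.mk X.lineStep x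
    rw [Matrix.mulVec_mulVec, Matrix.mul_nonsing_inv r hr, Matrix.one_mulVec]

/-- `lineEquiv r` sends the line `o` to the line of `r *ᵥ Quot.out o`. -/
theorem lineEquiv_apply (r : Matrix (Fin 3) (Fin 3) X.E) (hr : IsUnit r.det) (o : X.Line) :
    lineEquiv X r hr o = Quot.mk X.lineStep (r *ᵥ Quot.out o) := by
  conv_lhs => rw [← Quot.out_eq o]
  rfl

end Lines

/-! ### 4. Unitarity: coset representatives of a Hecke element of level `Γ′` lie in `U(H)(E′)`, their transfers
`M(r)` are unitary for `J`, and they are units -/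

section Unitary

/-- `cstar` reverses products. -/
theorem cstar_mul_rev {E : Type} [Field E] (c : E ≃+* E) (A B : Matrix (Fin 3) (Fin 3) E) :
    cstar c (A * B) = cstar c B * cstar c A := by
  unfold cstar
  rw [Matrix.map_mul, Matrix.transpose_mul]

/-- `U(H)` is closed under multiplication. -/
theorem isUnitaryOf_mul {E : Type} [Field E] (c : E ≃+* E) (H : Matrix (Fin 3) (Fin 3) E)
    {A B : Matrix (Fin 3) (Fin 3) E} (hA : IsUnitaryOf c H A) (hB : IsUnitaryOf c H B) :
    IsUnitaryOf c H (A * B) := by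
  unfold IsUnitaryOf at *
  rw [cstar_mul_rev]
  calc cstar c B * cstar c A * H * (A * B) = cstar c B * (cstar c A * H * A) * B := by
        simp only [Matrix.mul_assoc]
    _ = H := by rw [hA, hB]

variable (X : T4Data)

/-- Elements of a level lie in `U(H)`. -/
theorem isUnitaryOf_of_mem_level (K : X.Level) {γ : Matrix (Fin 3) (Fin 3) X.E} (hγ : γ ∈ K.1) :
    IsUnitaryOf X.c X.H γ := by
  have hp : γ ∈ principalCongruence X.c X.H 1 := K.2.1.2.2.2.1 hγ
  exact hp.1

/-- Every coset representative of a Hecke element of level `K` lies in `U(H)(E′)`. -/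
theorem isUnitaryOf_of_isFor (K : X.Level) {h : HeckeElement X.E} (hh : h.IsFor X.c X.H K.1)
    {t : ℤ × Finset (Matrix (Fin 3) (Fin 3) X.E)} (ht : t ∈ h.terms)
    {r : Matrix (Fin 3) (Fin 3) X.E} (hr : r ∈ t.2) : IsUnitaryOf X.c X.H r := by
  obtain ⟨g, hg, hreps⟩ := hh t ht
  obtain ⟨γ₁, hγ₁, γ₂, hγ₂, rfl⟩ := hreps.1 r hr
  exact isUnitaryOf_mul X.c X.H (isUnitaryOf_mul X.c X.H (isUnitaryOf_of_mem_level X K hγ₁) hg)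
    (isUnitaryOf_of_mem_level X K hγ₂)

/-- `H` is a unit (anisotropy). -/
theorem isUnit_H : IsUnit X.H := by
  rw [← Matrix.mulVec_injective_iff_isUnit]
  intro v w hvw
  have h0 : X.H *ᵥ (v - w) = 0 := by
    rw [Matrix.mulVec_sub, hvw, sub_self]
  have h1 : hform X.c X.H (v - w) (v - w) = 0 := by
    unfold hform
    rw [h0, dotProduct_zero]
  exact sub_eq_zero.mp (X.hAn _ h1)

/-- An element of `U(H)` has a unit determinant. -/
theorem isUnit_det_of_isUnitaryOf {r : Matrix (Fin 3) (Fin 3) X.E} (hr : IsUnitaryOf X.c X.H r) :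
    IsUnit r.det := by
  have hH : IsUnit X.H.det := (Matrix.isUnit_iff_isUnit_det X.H).mp (isUnit_H X)
  have h : (cstar X.c r * X.H * r).det = X.H.det := by
    unfold IsUnitaryOf at hr
    rw [hr]
  rw [Matrix.det_mul, Matrix.det_mul] at h
  have h2 : IsUnit ((cstar X.c r).det * X.H.det * r.det) := by
    rw [h]
    exact hH
  exact (IsUnit.mul_iff.mp h2).2

/-- `M(r)` is unitary for `J` when `r ∈ U(H)(E′)`. -/
theorem toBallMat_J_of_unitary {r : Matrix (Fin 3) (Fin 3) X.E} (hr : IsUnitaryOf X.c X.H r) :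
    (toBallMat X.τ₀ X.C r)ᴴ * J * toBallMat X.τ₀ X.C r = J :=
  toBallMat_J X.τ₀ X.c (fun x => complexConj_intertwines X.E X.τ₀ x) X.hC hr

/-- The `J`-unitarity in the form of `ThetaData.equiv`. -/
theorem isUnitaryOf_J_of_conjTranspose {M : Matrix (Fin 3) (Fin 3) ℂ} (hM : Mᴴ * J * M = J) :
    IsUnitaryOf (starRingAut : ℂ ≃+* ℂ) J M := by
  unfold IsUnitaryOf
  have h : cstar (starRingAut : ℂ ≃+* ℂ) M = Mᴴ := by
    ext i j
    simp [cstar, Matrix.conjTranspose_apply]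
  rw [h]
  exact hM

end Unitary

/-! ### 5. Finite sums through `tsum` -/

/-- A list sum of summable functions is summable, and `tsum` commutes with it. -/
theorem tsum_list_sum {ι β : Type} (l : List ι) (A : ι → β → ℂ) (hA : ∀ t ∈ l, Summable (A t)) :
    Summable (fun o => (l.map (fun t => A t o)).sum) ∧
    ∑' o, (l.map (fun t => A t o)).sum = (l.map (fun t => ∑' o, A t o)).sum := by
  induction l with
  | nil =>
    simp only [List.map_nil, List.sum_nil]
    exact ⟨summable_zero, tsum_zero⟩
  | cons t l ih =>
    obtain ⟨ihs, ihe⟩ := ih (fun t' ht' => hA t' (by simp [ht']))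
    have hAt : Summable (A t) := hA t (by simp)
    simp only [List.map_cons, List.sum_cons]
    exact ⟨hAt.add ihs, by rw [hAt.tsum_add ihs, ihe]⟩

end HeckeEquivariance

end Summit.Ventures.HodgeRepro.Tier4.Line3

end
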